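import Mathlib
import Literature.NumberTheory.LFunctions.VanDerCorputZeta
import HarnessLib

/-!
# The Fejér-type kernel of Ford's Lemma 5.1: Fourier series of the triangle wave

Topic `Literature/NumberTheory/LFunctions`.  Everything in this file is PROVED; no named fact is
introduced (the `def`s are the triangle wave, its Fourier coefficients and Ford's weights `f_j`).

For `0 < w ≤ 1/2` let `ℓ(x; w) = max(0, 1 - ‖x‖/w)` (`‖x‖` the distance to the nearest integer).
Ford (*Vinogradov's integral and bounds for the Riemann zeta function*, Proc. LMS 85 (2002),
proof of Lemma 5.1) uses its absolutely convergent Fourier series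
`ℓ(x; w) = (1/(π² w)) ∑_{n ∈ ℤ} (sin(πnw)/n)² e(nx)` (the term `n = 0` being `w`), in the form:
for `R > 0` and `f_R(c) = (R sin(πc/(2R))/c)²` (`f_R(0) = π²/4`),
`∑_{c ∈ ℤ} f_R(c) e(cθ) = (π² R/2) ℓ(θ; 1/(2R))`, a nonnegative quantity `≤ 5R` vanishing unless
`‖θ‖ < 1/(2R)`, while `f_R(c) ≥ 1` for `1 ≤ c ≤ R` (so that the weights `f_R` majorize the
indicator of `[1, R]`).

* `FordVK.fourierCoeff_triC` — the Fourier coefficients of `ℓ(·; w)`;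
* `FordVK.hasSum_tri` — `HasSum (n ↦ ℓ̂(n) e(nx)) ℓ(x; w)`;
* `FordVK.hasSum_fejerWeight` — `HasSum (c ↦ f_R(c) e(cθ)) ((π² R/2) ℓ(θ; 1/(2R)))`;
* `FordVK.one_le_fejerWeight` — `f_R(c) ≥ 1` for `1 ≤ c ≤ R` (Jordan's inequality).

## References

* K. Ford, *Vinogradov's integral and bounds for the Riemann zeta function*, Proc. London Math.
  Soc. (3) 85 (2002), 565–633; arXiv:1910.08209. Proof of Lemma 5.1 (the functions `ℓ(x;w)` and
  `f_j`). [Ford2002]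
* Mathlib, `has_pointwise_sum_fourier_series_of_summable`. [folklore]
-/

noncomputable section

open Real MeasureTheory Complex Set intervalIntegral

namespace Literature.NumberTheory.LFunctions
namespace FordVK

open VdC

/-! ### The triangle wave and its lift to the circle -/

/-- The triangle wave `ℓ(x; w) = max(0, 1 - ‖x‖/w)`, `‖x‖ = |x - round x|` the distance to the
nearest integer. [cite: Ford2002, proof of Lemma 5.1] -/
def tri (w x : ℝ) : ℝ := max 0 (1 - |x - round x| / w)

/-- `ℓ ≥ 0`. [folklore] -/
theorem tri_nonneg (w x : ℝ) : 0 ≤ tri w x := le_max_left _ _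

/-- `ℓ ≤ 1` (`w > 0`). [folklore] -/
theorem tri_le_one {w : ℝ} (hw : 0 < w) (x : ℝ) : tri w x ≤ 1 := by
  unfold tri
  refine max_le zero_le_one ?_
  have : 0 ≤ |x - round x| / w := by positivity
  linarith

/-- `ℓ(x; w) = 0` unless `‖x‖ < w` (`w > 0`). [folklore] -/
theorem tri_eq_zero_of_le {w x : ℝ} (hw : 0 < w) (h : w ≤ |x - round x|) : tri w x = 0 := by
  unfold tri
  refine max_eq_left ?_
  rw [sub_nonpos, le_div_iff₀ hw, one_mul]
  exact h

/-- `ℓ` is `ℤ`-periodic. [folklore] -/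
theorem tri_add_int (w x : ℝ) (m : ℤ) : tri w (x + m) = tri w x := by
  unfold tri
  rw [round_add_intCast]
  push_cast
  ring_nf

/-- The triangle wave on the circle `ℝ/ℤ`, as a continuous map. [folklore] -/
def triC (w : ℝ) : C(UnitAddCircle, ℂ) where
  toFun y := ((max 0 (1 - ‖y‖ / w) : ℝ) : ℂ)
  continuous_toFun := by
    refine Complex.continuous_ofReal.comp ?_
    exact continuous_const.max (continuous_const.sub (continuous_norm.div_const _))

/-- `triC` lifts `tri`. [folklore] -/
theorem triC_coe (w x : ℝ) : triC w (x : UnitAddCircle) = (tri w x : ℂ) := by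
  show ((max 0 (1 - ‖(x : UnitAddCircle)‖ / w) : ℝ) : ℂ) = (tri w x : ℂ)
  rw [UnitAddCircle.norm_eq]
  rfl

/-! ### The Fourier coefficients -/

/-- `ℓ̂(n) = sin²(πnw)/(π²n²w)` (`n ≠ 0`), `ℓ̂(0) = w`. [cite: Ford2002, proof of Lemma 5.1] -/
def triCoeff (w : ℝ) (n : ℤ) : ℝ :=
  if n = 0 then w else Real.sin (π * n * w) ^ 2 / (π ^ 2 * n ^ 2 * w)

/-- `ℓ̂(n) ≥ 0` (`w > 0`). [folklore] -/
theorem triCoeff_nonneg {w : ℝ} (hw : 0 < w) (n : ℤ) : 0 ≤ triCoeff w n := by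
  unfold triCoeff
  split_ifs
  · exact hw.le
  · positivity

/-- `|ℓ̂(n)| ≤ (1/(π² w)) / n²`. [folklore] -/
theorem triCoeff_le {w : ℝ} (hw : 0 < w) {n : ℤ} (hn : n ≠ 0) :
    triCoeff w n ≤ 1 / (π ^ 2 * w) * (1 / (n : ℝ) ^ 2) := by
  unfold triCoeff
  rw [if_neg hn]
  have hn2 : (0 : ℝ) < (n : ℝ) ^ 2 := by
    have : (n : ℝ) ≠ 0 := by exact_mod_cast hn
    positivity
  rw [div_le_iff₀ (by positivity)]
  calc Real.sin (π * n * w) ^ 2 ≤ 1 := by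
        rw [sq_le_one_iff_abs_le_one]; exact Real.abs_sin_le_one _
    _ = 1 / (π ^ 2 * w) * (1 / (n : ℝ) ^ 2) * (π ^ 2 * n ^ 2 * w) := by
        field_simp

/-- The coefficients are summable. [folklore] -/
theorem summable_triCoeff {w : ℝ} (hw : 0 < w) : Summable (triCoeff w) := by
  have hs : Summable fun n : ℤ => 1 / (π ^ 2 * w) * (1 / (n : ℝ) ^ 2) :=
    (summable_one_div_int_pow.2 one_lt_two).mul_left _
  refine Summable.of_nonneg_of_le (fun n => triCoeff_nonneg hw n) (fun n => ?_)
    (hs.add (summable_of_ne_finset_zero (s := {0}) (f := fun n : ℤ => if n = 0 then w else 0)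
      (by intro n hn; rw [Finset.mem_singleton] at hn; simp [hn])))
  by_cases hn : n = 0
  · subst hn; simp [triCoeff]
  · rw [if_neg hn, add_zero]; exact triCoeff_le hw hn

/-- An antiderivative for `(1 - x/w) e^{cx}`. [folklore] -/
theorem hasDerivAt_antideriv_right {w : ℝ} (hw : w ≠ 0) {c : ℂ} (hc : c ≠ 0) (x : ℝ) :
    HasDerivAt (fun y : ℝ => ((1 - (y : ℂ) / w) / c + 1 / (w * c ^ 2)) * Complex.exp (c * y))
      ((1 - (x : ℂ) / w) * Complex.exp (c * x)) x := by
  have hw' : (w : ℂ) ≠ 0 := by exact_mod_cast hw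
  have h1 := (((hasDerivAt_id x).ofReal_comp.div_const (w : ℂ)).const_sub 1).div_const c
      |>.add_const (1 / ((w : ℂ) * c ^ 2))
  have h2 := ((hasDerivAt_id x).ofReal_comp.const_mul c).cexp
  have h3 := h1.mul h2
  refine (h3.congr_deriv ?_ : HasDerivAt (fun y : ℝ =>
    ((1 - (((id y : ℝ) : ℂ)) / w) / c + 1 / (w * c ^ 2)) * Complex.exp (c * ((id y : ℝ) : ℂ))) _ x)
  simp only [id_eq]
  push_cast
  field_simp
  ring

/-- An antiderivative for `(1 + x/w) e^{cx}`. [folklore] -/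
theorem hasDerivAt_antideriv_left {w : ℝ} (hw : w ≠ 0) {c : ℂ} (hc : c ≠ 0) (x : ℝ) :
    HasDerivAt (fun y : ℝ => ((1 + (y : ℂ) / w) / c - 1 / (w * c ^ 2)) * Complex.exp (c * y))
      ((1 + (x : ℂ) / w) * Complex.exp (c * x)) x := by
  have hw' : (w : ℂ) ≠ 0 := by exact_mod_cast hw
  have h1 := (((hasDerivAt_id x).ofReal_comp.div_const (w : ℂ)).const_add 1).div_const c
      |>.sub_const (1 / ((w : ℂ) * c ^ 2))
  have h2 := ((hasDerivAt_id x).ofReal_comp.const_mul c).cexp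
  have h3 := h1.mul h2
  refine (h3.congr_deriv ?_ : HasDerivAt (fun y : ℝ =>
    ((1 + (((id y : ℝ) : ℂ)) / w) / c - 1 / (w * c ^ 2)) * Complex.exp (c * ((id y : ℝ) : ℂ))) _ x)
  simp only [id_eq]
  push_cast
  field_simp
  ring

/-- `∫_0^w (1 - x/w) e^{cx} dx = (e^{cw} - 1 - cw)/(w c²)` (`c ≠ 0`). [folklore] -/
theorem integral_right {w : ℝ} (hw : 0 < w) {c : ℂ} (hc : c ≠ 0) :
    ∫ x in (0 : ℝ)..w, (1 - (x : ℂ) / w) * Complex.exp (c * x)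
      = (Complex.exp (c * w) - 1 - c * w) / (w * c ^ 2) := by
  rw [integral_eq_sub_of_hasDerivAt (fun x _ => hasDerivAt_antideriv_right hw.ne' hc x)]
  · have hw' : (w : ℂ) ≠ 0 := by exact_mod_cast hw.ne'
    push_cast
    rw [mul_zero, Complex.exp_zero]
    field_simp
    ring
  · exact (Continuous.continuousOn (by fun_prop)).intervalIntegrable

/-- `∫_{-w}^0 (1 + x/w) e^{cx} dx = (e^{-cw} - 1 + cw)/(w c²)` (`c ≠ 0`). [folklore] -/
theorem integral_left {w : ℝ} (hw : 0 < w) {c : ℂ} (hc : c ≠ 0) :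
    ∫ x in (-w : ℝ)..0, (1 + (x : ℂ) / w) * Complex.exp (c * x)
      = (Complex.exp (-(c * w)) - 1 + c * w) / (w * c ^ 2) := by
  rw [integral_eq_sub_of_hasDerivAt (fun x _ => hasDerivAt_antideriv_left hw.ne' hc x)]
  · have hw' : (w : ℂ) ≠ 0 := by exact_mod_cast hw.ne'
    push_cast
    rw [mul_zero, Complex.exp_zero, show -(w : ℂ) / w = -1 by field_simp,
      show c * -(w : ℂ) = -(c * w) by ring]
    field_simp
    ring
  · exact (Continuous.continuousOn (by fun_prop)).intervalIntegrable


/-- For `|x| ≤ 1/2` the distance to the nearest integer is `|x|`. [folklore] -/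
theorem abs_sub_round_of_abs_le_half {x : ℝ} (hx : |x| ≤ 1 / 2) : |x - round x| = |x| := by
  rw [abs_le] at hx
  rcases lt_or_eq_of_le hx.2 with h | h
  · rw [round_eq_zero_iff.2 ⟨by linarith, h⟩, Int.cast_zero, sub_zero]
  · rw [h, round_eq, show (1 / 2 : ℝ) + 1 / 2 = 1 by norm_num]
    simp only [Int.floor_one, Int.cast_one]
    rw [abs_of_nonpos (by norm_num), abs_of_nonneg (by norm_num)]
    norm_num

/-- `ℓ(x; w) = max(0, 1 - |x|/w)` for `|x| ≤ 1/2`. [folklore] -/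
theorem tri_eq_of_abs_le_half (w : ℝ) {x : ℝ} (hx : |x| ≤ 1 / 2) :
    tri w x = max 0 (1 - |x| / w) := by
  unfold tri; rw [abs_sub_round_of_abs_le_half hx]

/-- The integrand of the Fourier coefficient, as a function on `ℝ`. [folklore] -/
def coeffIntegrand (w : ℝ) (n : ℤ) (x : ℝ) : ℂ :=
  fourier (-n) (x : UnitAddCircle) • triC w (x : UnitAddCircle)

/-- The integrand is continuous. [folklore] -/
theorem continuous_coeffIntegrand (w : ℝ) (n : ℤ) : Continuous (coeffIntegrand w n) := by
  unfold coeffIntegrand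
  have hc : Continuous ((↑) : ℝ → UnitAddCircle) := continuous_quotient_mk'
  exact ((fourier (-n)).continuous.comp hc).smul ((triC w).continuous.comp hc)

/-- Explicit form of the integrand on `[-1/2, 1/2]`:
`e(-nx) max(0, 1 - |x|/w)`. [folklore] -/
theorem coeffIntegrand_eq (w : ℝ) (n : ℤ) {x : ℝ} (hx : |x| ≤ 1 / 2) :
    coeffIntegrand w n x
      = Complex.exp (-(2 * π * Complex.I * n) * x) * ((max 0 (1 - |x| / w) : ℝ) : ℂ) := by
  unfold coeffIntegrand
  rw [fourier_coe_apply, triC_coe, tri_eq_of_abs_le_half w hx, smul_eq_mul]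
  congr 1
  push_cast
  ring_nf

/-- Outside `[-w, w]` (within `[-1/2, 1/2]`) the integrand vanishes. [folklore] -/
theorem coeffIntegrand_eq_zero {w : ℝ} (hw : 0 < w) (n : ℤ) {x : ℝ} (hx : |x| ≤ 1 / 2)
    (hxw : w ≤ |x|) : coeffIntegrand w n x = 0 := by
  rw [coeffIntegrand_eq w n hx, max_eq_left, Complex.ofReal_zero, mul_zero]
  rw [sub_nonpos, le_div_iff₀ hw, one_mul]; exact hxw

/-- On `[-w, 0]`: the integrand is `(1 + x/w) e^{cx}`, `c = -2πin`. [folklore] -/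
theorem coeffIntegrand_eq_left {w : ℝ} (hw : 0 < w) (hw2 : w ≤ 1 / 2) (n : ℤ) {x : ℝ}
    (hx : x ∈ Set.Icc (-w) 0) :
    coeffIntegrand w n x = (1 + (x : ℂ) / w) * Complex.exp (-(2 * π * Complex.I * n) * x) := by
  have hxa : |x| ≤ 1 / 2 := by rw [abs_le]; constructor <;> linarith [hx.1, hx.2]
  rw [coeffIntegrand_eq w n hxa, abs_of_nonpos hx.2, max_eq_right, mul_comm]
  · congr 1; push_cast; ring
  · rw [sub_nonneg, div_le_one hw]; linarith [hx.1]

/-- On `[0, w]`: the integrand is `(1 - x/w) e^{cx}`, `c = -2πin`. [folklore] -/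
theorem coeffIntegrand_eq_right {w : ℝ} (hw : 0 < w) (hw2 : w ≤ 1 / 2) (n : ℤ) {x : ℝ}
    (hx : x ∈ Set.Icc 0 w) :
    coeffIntegrand w n x = (1 - (x : ℂ) / w) * Complex.exp (-(2 * π * Complex.I * n) * x) := by
  have hxa : |x| ≤ 1 / 2 := by rw [abs_le]; constructor <;> linarith [hx.1, hx.2]
  rw [coeffIntegrand_eq w n hxa, abs_of_nonneg hx.1, max_eq_right, mul_comm]
  · congr 1; push_cast; ring
  · rw [sub_nonneg, div_le_one hw]; exact hx.2

/-- **The Fourier coefficients of the triangle wave** (`0 < w ≤ 1/2`):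
`ℓ̂(n) = sin²(πnw)/(π²n²w)` for `n ≠ 0` and `ℓ̂(0) = w`. [cite: Ford2002, proof of Lemma 5.1] -/
theorem fourierCoeff_triC {w : ℝ} (hw : 0 < w) (hw2 : w ≤ 1 / 2) (n : ℤ) :
    fourierCoeff (triC w) n = (triCoeff w n : ℂ) := by
  rw [fourierCoeff_eq_intervalIntegral (triC w) n (-(1 / 2)), div_one, one_smul,
    show (-(1 / 2) : ℝ) + 1 = 1 / 2 by norm_num]
  change ∫ x in (-(1 / 2) : ℝ)..1 / 2, coeffIntegrand w n x = _
  have hint : ∀ a b : ℝ, IntervalIntegrable (coeffIntegrand w n) volume a b := fun a b =>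
    (continuous_coeffIntegrand w n).intervalIntegrable a b
  rw [← integral_add_adjacent_intervals (hint (-(1 / 2)) (-w)) (hint (-w) (1 / 2)),
    ← integral_add_adjacent_intervals (hint (-w) 0) (hint 0 (1 / 2)),
    ← integral_add_adjacent_intervals (hint 0 w) (hint w (1 / 2))]
  -- the two outer pieces vanish
  have p1 : ∫ x in (-(1 / 2) : ℝ)..(-w), coeffIntegrand w n x = 0 := by
    rw [integral_congr (g := fun _ => (0 : ℂ)) fun x hx => ?_, intervalIntegral.integral_zero]
    rw [Set.uIcc_of_le (by linarith)] at hx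
    have hxa : |x| ≤ 1 / 2 := by rw [abs_le]; constructor <;> linarith [hx.1, hx.2]
    exact coeffIntegrand_eq_zero hw n hxa (by rw [abs_of_nonpos (by linarith [hx.2])]; linarith [hx.2])
  have p4 : ∫ x in (w : ℝ)..(1 / 2), coeffIntegrand w n x = 0 := by
    rw [integral_congr (g := fun _ => (0 : ℂ)) fun x hx => ?_, intervalIntegral.integral_zero]
    rw [Set.uIcc_of_le hw2] at hx
    have hxa : |x| ≤ 1 / 2 := by rw [abs_le]; constructor <;> linarith [hx.1, hx.2]
    exact coeffIntegrand_eq_zero hw n hxa (by rw [abs_of_nonneg (by linarith [hx.1])]; exact hx.1)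
  have p2 : ∫ x in (-w : ℝ)..0, coeffIntegrand w n x
      = ∫ x in (-w : ℝ)..0, (1 + (x : ℂ) / w) * Complex.exp (-(2 * π * Complex.I * n) * x) := by
    refine integral_congr fun x hx => ?_
    rw [Set.uIcc_of_le (by linarith)] at hx
    exact coeffIntegrand_eq_left hw hw2 n hx
  have p3 : ∫ x in (0 : ℝ)..w, coeffIntegrand w n x
      = ∫ x in (0 : ℝ)..w, (1 - (x : ℂ) / w) * Complex.exp (-(2 * π * Complex.I * n) * x) := by
    refine integral_congr fun x hx => ?_
    rw [Set.uIcc_of_le hw.le] at hx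
    exact coeffIntegrand_eq_right hw hw2 n hx
  rw [p1, p4, p2, p3, zero_add, add_zero]
  have hw' : (w : ℂ) ≠ 0 := by exact_mod_cast hw.ne'
  rcases eq_or_ne n 0 with hn | hn
  · -- `n = 0`: the area of the triangle
    subst hn
    simp only [Int.cast_zero, mul_zero, neg_zero, zero_mul, Complex.exp_zero, mul_one, triCoeff,
      if_true]
    have hid : ∀ a b : ℝ, ∫ x in a..b, (x : ℂ) / w = (((b ^ 2 - a ^ 2) / 2 / w : ℝ) : ℂ) := by
      intro a b
      rw [intervalIntegral.integral_div, intervalIntegral.integral_ofReal (f := fun x : ℝ => x),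
        integral_id]
      push_cast
      ring
    have hci : ∀ a b : ℝ, IntervalIntegrable (fun x : ℝ => (x : ℂ) / w) volume a b := fun a b =>
      (continuous_ofReal.div_const _).intervalIntegrable _ _
    rw [intervalIntegral.integral_add intervalIntegrable_const (hci _ _),
      intervalIntegral.integral_sub intervalIntegrable_const (hci _ _), hid, hid,
      intervalIntegral.integral_const, intervalIntegral.integral_const, Complex.real_smul,
      Complex.real_smul]
    push_cast
    field_simp
    ring
  · -- `n ≠ 0`
    set c : ℂ := -(2 * π * Complex.I * n) with hc
    have hc0 : c ≠ 0 := by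
      rw [hc]
      have : (n : ℂ) ≠ 0 := by exact_mod_cast hn
      have hπ : (π : ℂ) ≠ 0 := by exact_mod_cast Real.pi_ne_zero
      simp [this, hπ, Complex.I_ne_zero]
    rw [integral_left hw hc0, integral_right hw hc0, ← add_div,
      show Complex.exp (-(c * w)) - 1 + c * w + (Complex.exp (c * w) - 1 - c * w)
        = Complex.exp (c * w) + Complex.exp (-(c * w)) - 2 by ring]
    -- `e^{cw} + e^{-cw} = 2 cos(2πnw)` and `c² = -4π²n²`
    set z : ℝ := 2 * π * n * w with hz
    have hcw : c * w = -(z : ℂ) * Complex.I := by rw [hc, hz]; push_cast; ring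
    have hcos : Complex.exp (c * w) + Complex.exp (-(c * w)) = 2 * (Real.cos z : ℂ) := by
      rw [hcw, neg_mul, neg_neg, Complex.exp_mul_I, show -((z : ℂ) * Complex.I) = (-z : ℂ) * Complex.I
        by ring, Complex.exp_mul_I, Complex.cos_neg, Complex.sin_neg, Complex.ofReal_cos]
      ring
    have hc2 : c ^ 2 = -(4 * π ^ 2 * (n : ℂ) ^ 2) := by
      rw [hc]; ring_nf; rw [Complex.I_sq]; ring
    rw [hcos, hc2]
    unfold triCoeff
    rw [if_neg hn]
    have hreal : Real.sin (π * n * w) ^ 2 / (π ^ 2 * n ^ 2 * w) = (1 - Real.cos z) / (2 * π ^ 2 * n ^ 2 * w) := by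
      have h1 : Real.cos z = 1 - 2 * Real.sin (π * n * w) ^ 2 := by
        rw [hz, show 2 * π * (n : ℝ) * w = 2 * (π * n * w) by ring, Real.cos_two_mul',
          Real.cos_sq']
        ring
      rw [h1]
      have hn' : (n : ℝ) ≠ 0 := by exact_mod_cast hn
      field_simp
      ring
    rw [hreal]
    have hn' : (n : ℂ) ≠ 0 := by exact_mod_cast hn
    have hπ : (π : ℂ) ≠ 0 := by exact_mod_cast Real.pi_ne_zero
    push_cast
    field_simp
    ring

/-! ### Summation of the Fourier series -/

/-- **The Fourier series of the triangle wave converges to it**: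
`ℓ(x; w) = ∑_{n ∈ ℤ} ℓ̂(n) e(nx)` (`0 < w ≤ 1/2`). [cite: Ford2002, proof of Lemma 5.1] -/
theorem hasSum_tri {w : ℝ} (hw : 0 < w) (hw2 : w ≤ 1 / 2) (x : ℝ) :
    HasSum (fun n : ℤ => (triCoeff w n : ℂ) * e (n * x)) (tri w x : ℂ) := by
  have hsum : Summable (fourierCoeff (triC w)) := by
    have : fourierCoeff (triC w) = fun n => ((triCoeff w n : ℝ) : ℂ) :=
      funext fun n => fourierCoeff_triC hw hw2 n
    rw [this]
    exact Complex.summable_ofReal.2 (summable_triCoeff hw)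
  have h := has_pointwise_sum_fourier_series_of_summable hsum (x : UnitAddCircle)
  rw [triC_coe] at h
  convert h using 1
  funext n
  rw [fourierCoeff_triC hw hw2 n, fourier_coe_apply, smul_eq_mul, e]
  congr 1
  push_cast
  ring_nf


/-! ### Ford's weights `f_R(c) = (R sin(πc/(2R))/c)²` -/

/-- Ford's weight `f_R(c) = (R sin(πc/(2R))/c)²` (`c ≠ 0`), `f_R(0) = π²/4` (the limit value); in
Lemma 5.1, `R = r M^j` for the `j`-th coordinate. [cite: Ford2002, proof of Lemma 5.1 (`f_j`)] -/
def fejerWeight (R : ℝ) (c : ℤ) : ℝ :=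
  if c = 0 then π ^ 2 / 4 else (R * Real.sin (π * c / (2 * R)) / c) ^ 2

/-- `f_R ≥ 0`. [folklore] -/
theorem fejerWeight_nonneg (R : ℝ) (c : ℤ) : 0 ≤ fejerWeight R c := by
  unfold fejerWeight; split_ifs <;> positivity

/-- `f_R(c) = (π² R/2) ℓ̂(c)` with `w = 1/(2R)`. [cite: Ford2002, proof of Lemma 5.1] -/
theorem fejerWeight_eq {R : ℝ} (hR : 0 < R) (c : ℤ) :
    fejerWeight R c = π ^ 2 * R / 2 * triCoeff (1 / (2 * R)) c := by
  unfold fejerWeight triCoeff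
  split_ifs with hc
  · field_simp; norm_num
  · have hc' : (c : ℝ) ≠ 0 := by exact_mod_cast hc
    rw [show π * (c : ℝ) * (1 / (2 * R)) = π * c / (2 * R) by field_simp]
    field_simp

/-- **`f_R(c) ≥ 1` for `1 ≤ c ≤ R`** (Jordan's inequality `sin x ≥ 2x/π` on `[0, π/2]`), so the
weights majorize the indicator of `[1, R]`. [cite: Ford2002, proof of Lemma 5.1 ("`f_j(x) ≥ 1` for
`1 ≤ x ≤ rM^j`")] -/
theorem one_le_fejerWeight {R : ℝ} {c : ℤ} (hc1 : 1 ≤ c) (hcR : (c : ℝ) ≤ R) :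
    1 ≤ fejerWeight R c := by
  have hc0 : (0 : ℝ) < c := by exact_mod_cast (show (0 : ℤ) < c by omega)
  have hR : 0 < R := lt_of_lt_of_le hc0 hcR
  unfold fejerWeight
  rw [if_neg (by omega)]
  have hx0 : 0 ≤ π * c / (2 * R) := by positivity
  have hx1 : π * c / (2 * R) ≤ π / 2 := by
    rw [div_le_div_iff₀ (by positivity) (by norm_num)]
    nlinarith [Real.pi_pos]
  have hsin := Real.mul_le_sin hx0 hx1
  have h1 : 1 ≤ R * Real.sin (π * c / (2 * R)) / c := by
    rw [le_div_iff₀ hc0, one_mul]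
    calc (c : ℝ) = R * (2 / π * (π * c / (2 * R))) := by field_simp
      _ ≤ R * Real.sin (π * c / (2 * R)) := mul_le_mul_of_nonneg_left hsin hR.le
  nlinarith

/-- **`∑_{c ∈ ℤ} f_R(c) e(cθ) = (π² R/2) ℓ(θ; 1/(2R))`** (`R ≥ 1`).
[cite: Ford2002, proof of Lemma 5.1] -/
theorem hasSum_fejerWeight {R : ℝ} (hR : 1 ≤ R) (θ : ℝ) :
    HasSum (fun c : ℤ => (fejerWeight R c : ℂ) * e (c * θ))
      (((π ^ 2 * R / 2 * tri (1 / (2 * R)) θ : ℝ) : ℂ)) := by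
  have hR0 : 0 < R := by linarith
  have hw : 0 < 1 / (2 * R) := by positivity
  have hw2 : 1 / (2 * R) ≤ 1 / 2 := by
    rw [div_le_div_iff₀ (by positivity) (by norm_num)]; linarith
  have h := (hasSum_tri hw hw2 θ).mul_left ((π ^ 2 * R / 2 : ℝ) : ℂ)
  have hf : (fun c : ℤ => (fejerWeight R c : ℂ) * e (c * θ))
      = fun c : ℤ => ((π ^ 2 * R / 2 : ℝ) : ℂ) * ((triCoeff (1 / (2 * R)) c : ℂ) * e (c * θ)) := by
    funext c
    rw [fejerWeight_eq hR0 c]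
    push_cast
    ring
  rw [hf]
  have hv : (((π ^ 2 * R / 2 * tri (1 / (2 * R)) θ : ℝ) : ℂ))
      = ((π ^ 2 * R / 2 : ℝ) : ℂ) * (tri (1 / (2 * R)) θ : ℂ) := by push_cast; ring
  rw [hv]
  exact h

/-- The value of the sum is nonnegative, at most `5R`, and vanishes unless `‖θ‖ < 1/(2R)`.
[cite: Ford2002, proof of Lemma 5.1 and (5.4)] -/
theorem fejerSum_nonneg (R θ : ℝ) (hR : 0 ≤ R) : 0 ≤ π ^ 2 * R / 2 * tri (1 / (2 * R)) θ :=
  mul_nonneg (by positivity) (tri_nonneg _ _)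

/-- `(π² R/2) ℓ ≤ 5R`. [cite: Ford2002, (5.4)] -/
theorem fejerSum_le {R : ℝ} (hR : 0 < R) (θ : ℝ) : π ^ 2 * R / 2 * tri (1 / (2 * R)) θ ≤ 5 * R := by
  have h1 := tri_le_one (w := 1 / (2 * R)) (by positivity) θ
  have hπ : π ^ 2 / 2 ≤ 5 := by nlinarith [Real.pi_lt_d2, Real.pi_pos]
  calc π ^ 2 * R / 2 * tri (1 / (2 * R)) θ ≤ π ^ 2 * R / 2 * 1 := by gcongr
    _ = π ^ 2 / 2 * R := by ring
    _ ≤ 5 * R := mul_le_mul_of_nonneg_right hπ hR.le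

/-- The sum vanishes unless `‖θ‖ < 1/(2R)`. [cite: Ford2002, proof of Lemma 5.1 (definition of `𝒟_j`)] -/
theorem fejerSum_eq_zero {R : ℝ} (hR : 0 < R) {θ : ℝ} (h : 1 / (2 * R) ≤ |θ - round θ|) :
    π ^ 2 * R / 2 * tri (1 / (2 * R)) θ = 0 := by
  rw [tri_eq_zero_of_le (by positivity) h, mul_zero]

/-- Summability of the weights (through the Fourier coefficients). [folklore] -/
theorem summable_fejerWeight {R : ℝ} (hR : 0 < R) : Summable (fejerWeight R) := by
  have : fejerWeight R = fun c => π ^ 2 * R / 2 * triCoeff (1 / (2 * R)) c :=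
    funext fun c => fejerWeight_eq hR c
  rw [this]
  exact (summable_triCoeff (by positivity)).mul_left _

end FordVK
end Literature.NumberTheory.LFunctions
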